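import Summits.SmoothPoincare4.SmoothPoincare4.Theses.SullivanDual
import Literature.Geometry.Symplectic.GromovR4StdModel
import Literature.Geometry.Kaehler.ManifoldFormsChart

/-!
# Collar lemma for taming witnesses (2/5): the flat collar forms `d(f(‖y‖²) λ₀)` on `ℝ⁴`

Support file for the stub `stub_collar` of the line `Sketch` (pencil-incompleteness) of the crux
`WitnessCharge` (`stmt-SmoothPoincare4-7824`, thesis `SullivanDual`). Pure `ℝ⁴` calculus
(`ℝ⁴ = EuclideanSpace ℝ (Fin 4)`, `ω₀ = stdSymplecticForm` of `StandardEnd.lean`), free of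
definitions:

* the `ω₀`-dual rotation: a vector `w` with `⟪w, c⟫ = ω₀(u, c)` for all `c` (this is how the
  chart-level standardness clause of the crux pins `J`) is `J₀ u = (-u₁, u₀, -u₃, u₂)`, so
  `‖w‖ = ‖u‖`, `ω₀(u, w) = ‖u‖²`, `ω₀(y, w) = ⟪y, u⟫`, `ω₀(y, u) = -⟪y, w⟫`;
* `stub_collar_flatCollarForm` (registered sub-goal of `stub_collar`) — for a `C^∞` profile `f` with `f' ≥ 0` the `2`-form
  `Ψ = d(½ f(‖y‖²) ω₀(y, ·))` on `ℝ⁴` (Mathlib's `extDeriv`; typed as a manifold form on the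
  model `ℝ⁴`) is smooth and closed, equals `c ω₀` where `f ≡ c` near `‖y‖²`, and dominates
  `f(‖y‖²) ‖u‖²` on complex lines `(u, J₀ u)`:
  `Ψ(a, b) = f ω₀(a, b) + f' (⟪y, a⟫ ω₀(y, b) - ⟪y, b⟫ ω₀(y, a))`,
  `Ψ(u, J₀ u) = f ‖u‖² + f' (⟪y, u⟫² + ⟪y, J₀ u⟫²)`.

## References

* M. Gromov, *Pseudo holomorphic curves in symplectic manifolds*, Invent. Math. 82 (1985),
  §0.3.C, 2.4.A (the `i`-convex collar of the standard end). [Gromov1985]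
* D. McDuff, D. Salamon, *Introduction to Symplectic Topology*, 3rd ed. (2017), §1.1
  (`ω₀(v, J₀ v) = ‖v‖²`, the Liouville form). [McDuffSalamon2017]
-/

noncomputable section

-- Justification: all stub files of the line share the namespace of the skeleton
-- (`…Theorems.WitnessCharge.PencilIncompleteness`), which repeats the component `SmoothPoincare4`.
set_option linter.dupNamespace false

open scoped Manifold ContDiff Topology RealInnerProductSpace
open Set Filter Literature.Geometry.Kaehler Literature.Geometry.Symplectic

namespace Summit.SmoothPoincare4.SmoothPoincare4.Theorems.WitnessCharge.PencilIncompleteness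

/-! ### The `ω₀`-dual rotation -/

/-- **`ω₀` pins `J₀`**: if `⟪w, c⟫ = ω₀(u, c)` for every `c`, then `w = (-u₁, u₀, -u₃, u₂)`
coordinatewise. [cite: McDuffSalamon2017, §1.1] -/
theorem apply_of_inner_eq_std {u w : EuclideanSpace ℝ (Fin 4)}
    (h : ∀ c : EuclideanSpace ℝ (Fin 4), ⟪w, c⟫ = stdSymplecticForm u c) :
    w 0 = -u 1 ∧ w 1 = u 0 ∧ w 2 = -u 3 ∧ w 3 = u 2 := by
  have e : ∀ i : Fin 4, w i = stdSymplecticForm u (EuclideanSpace.single i 1) := fun i => by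
    rw [← h]
    simp [EuclideanSpace.inner_single_right]
  refine ⟨?_, ?_, ?_, ?_⟩ <;> (rw [e]; simp [stdSymplecticForm])

/-- The `ω₀`-dual rotation is an isometry: `‖w‖ = ‖u‖`. [folklore] -/
theorem norm_eq_of_inner_eq_std {u w : EuclideanSpace ℝ (Fin 4)}
    (h : ∀ c : EuclideanSpace ℝ (Fin 4), ⟪w, c⟫ = stdSymplecticForm u c) : ‖w‖ = ‖u‖ := by
  obtain ⟨h0, h1, h2, h3⟩ := apply_of_inner_eq_std h
  have hsq : ‖w‖ ^ 2 = ‖u‖ ^ 2 := by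
    rw [EuclideanSpace.real_norm_sq_eq, EuclideanSpace.real_norm_sq_eq, Fin.sum_univ_four,
      Fin.sum_univ_four, h0, h1, h2, h3]
    ring
  exact (sq_eq_sq₀ (norm_nonneg _) (norm_nonneg _)).1 hsq

/-- `ω₀(u, w) = ‖u‖²` for the `ω₀`-dual rotation `w` of `u`. [cite: McDuffSalamon2017, §1.1] -/
theorem stdSymplecticForm_eq_norm_sq_of_inner_eq_std {u w : EuclideanSpace ℝ (Fin 4)}
    (h : ∀ c : EuclideanSpace ℝ (Fin 4), ⟪w, c⟫ = stdSymplecticForm u c) :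
    stdSymplecticForm u w = ‖u‖ ^ 2 := by
  rw [← norm_eq_of_inner_eq_std h, ← real_inner_self_eq_norm_sq, h w]

/-- `ω₀(y, w) = ⟪y, u⟫` for the `ω₀`-dual rotation `w` of `u`. [folklore] -/
theorem stdSymplecticForm_left_eq_inner_of_inner_eq_std {u w : EuclideanSpace ℝ (Fin 4)}
    (h : ∀ c : EuclideanSpace ℝ (Fin 4), ⟪w, c⟫ = stdSymplecticForm u c)
    (y : EuclideanSpace ℝ (Fin 4)) : stdSymplecticForm y w = ⟪y, u⟫ := by
  obtain ⟨h0, h1, h2, h3⟩ := apply_of_inner_eq_std h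
  simp only [stdSymplecticForm, h0, h1, h2, h3]
  simp [PiLp.inner_apply, Fin.sum_univ_four, mul_comm]

/-- `ω₀(y, u) = -⟪y, w⟫` for the `ω₀`-dual rotation `w` of `u`. [folklore] -/
theorem stdSymplecticForm_eq_neg_inner_of_inner_eq_std {u w : EuclideanSpace ℝ (Fin 4)}
    (h : ∀ c : EuclideanSpace ℝ (Fin 4), ⟪w, c⟫ = stdSymplecticForm u c)
    (y : EuclideanSpace ℝ (Fin 4)) : stdSymplecticForm y u = -⟪y, w⟫ := by
  rw [real_inner_comm, h y, stdSymplecticForm_swap u y]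

/-- A `2`-form on `ℝ⁴` is determined by its values on pairs `![a, b]`. [folklore] -/
theorem twoForm_eq_of_apply_eq {φ ψ : EuclideanSpace ℝ (Fin 4) [⋀^Fin 2]→L[ℝ] ℝ}
    (h : ∀ a b, φ ![a, b] = ψ ![a, b]) : φ = ψ := by
  ext v
  have hv : v = ![v 0, v 1] := by
    funext i; fin_cases i <;> rfl
  rw [hv]
  exact h _ _

/-! ### The flat collar form -/

/-- **The flat collar forms.** For a `C^∞` profile `f : ℝ → ℝ` with `f' ≥ 0`, the `2`-form
`Ψ = d(½ f(‖y‖²) ω₀(y, ·))` on `ℝ⁴` (typed as a manifold form on the model `ℝ⁴`) is smooth and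
closed, equals `c ω₀` wherever `f ≡ c` near `‖y‖²` (in particular vanishes where `f ≡ 0`
locally), and dominates `f(‖y‖²) ‖u‖²` on every complex line `(u, w)`, `w = J₀ u` the
`ω₀`-dual rotation of `u`: indeed `Ψ(a, b) = f ω₀(a, b) + f'(⟪y, a⟫ ω₀(y, b) - ⟪y, b⟫ ω₀(y, a))`
and `Ψ(u, J₀ u) = f ‖u‖² + f'(⟪y, u⟫² + ⟪y, J₀ u⟫²)`. [cite: Gromov1985, 2.4.A] -/
theorem stub_collar_flatCollarForm :
    ∀ (f : ℝ → ℝ), ContDiff ℝ ∞ f → (∀ t : ℝ, 0 ≤ deriv f t) →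
      ∃ Ψ : MForm 𝓘(ℝ, EuclideanSpace ℝ (Fin 4)) (EuclideanSpace ℝ (Fin 4)) ℝ 2,
        (∀ z : EuclideanSpace ℝ (Fin 4), Ψ.SmoothAt z) ∧ mextDeriv Ψ = 0 ∧
        (∀ (y : EuclideanSpace ℝ (Fin 4)) (c : ℝ),
          Filter.EventuallyEq (nhds (‖y‖ ^ 2)) f (fun _ : ℝ => c) →
          ∀ u w : EuclideanSpace ℝ (Fin 4), Ψ y ![u, w] = c * stdSymplecticForm u w) ∧
        (∀ y : EuclideanSpace ℝ (Fin 4),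
          Filter.EventuallyEq (nhds (‖y‖ ^ 2)) f (fun _ : ℝ => 0) → Ψ y = 0) ∧
        (∀ y u w : EuclideanSpace ℝ (Fin 4),
          (∀ c : EuclideanSpace ℝ (Fin 4), inner ℝ w c = stdSymplecticForm u c) →
          f (‖y‖ ^ 2) * ‖u‖ ^ 2 ≤ Ψ y ![u, w]) := by
  intro f hf hf'
  -- the Liouville form `λ₀(y) = ω₀(y, ·)` as a continuous linear map of the point
  set L : EuclideanSpace ℝ (Fin 4) →L[ℝ] (EuclideanSpace ℝ (Fin 4) [⋀^Fin 1]→L[ℝ] ℝ) :=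
    ((ContinuousAlternatingMap.ofSubsingletonLIE (𝕜 := ℝ) (E := EuclideanSpace ℝ (Fin 4))
      (F := ℝ) (0 : Fin 1)).toContinuousLinearEquiv :
        (EuclideanSpace ℝ (Fin 4) →L[ℝ] ℝ) →L[ℝ] (EuclideanSpace ℝ (Fin 4) [⋀^Fin 1]→L[ℝ] ℝ)).comp
      stdSymplecticBilin with hL
  have hLv : ∀ (y : EuclideanSpace ℝ (Fin 4)) (v : Fin 1 → EuclideanSpace ℝ (Fin 4)),
      L y v = stdSymplecticForm y (v 0) := fun y v => by
    simp [hL]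
  -- the potential `θ(y) = f(‖y‖²) · ½ λ₀(y)`
  set θ : EuclideanSpace ℝ (Fin 4) → EuclideanSpace ℝ (Fin 4) [⋀^Fin 1]→L[ℝ] ℝ :=
    fun y => f (‖y‖ ^ 2) • ((2⁻¹ : ℝ) • L y) with hθ
  have hθv : ∀ (y : EuclideanSpace ℝ (Fin 4)) (v : Fin 1 → EuclideanSpace ℝ (Fin 4)),
      θ y v = f (‖y‖ ^ 2) * (2⁻¹ * stdSymplecticForm y (v 0)) := fun y v => by
    simp only [hθ, ContinuousAlternatingMap.smul_apply, hLv, smul_eq_mul]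
  have hθs : ContDiff ℝ ∞ θ :=
    (hf.comp (contDiff_norm_sq ℝ)).smul (L.contDiff.const_smul (2⁻¹ : ℝ))
  -- derivative of the coefficients of `θ`
  have hθd : ∀ (y : EuclideanSpace ℝ (Fin 4)) (v : Fin 1 → EuclideanSpace ℝ (Fin 4)),
      HasFDerivAt (fun z => θ z v)
        (f (‖y‖ ^ 2) • ((2⁻¹ : ℝ) • stdSymplecticBilin.flip (v 0)) +
          (2⁻¹ * stdSymplecticForm y (v 0)) •
            (deriv f (‖y‖ ^ 2) • ((2 : ℕ) • innerSL ℝ y))) y := by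
    intro y v
    have h1 : HasFDerivAt (fun z : EuclideanSpace ℝ (Fin 4) => f (‖z‖ ^ 2))
        (deriv f (‖y‖ ^ 2) • ((2 : ℕ) • innerSL ℝ y)) y :=
      ((hf.differentiable (by simp)) _).hasDerivAt.comp_hasFDerivAt y
        (hasStrictFDerivAt_norm_sq y).hasFDerivAt
    have h2 : HasFDerivAt (fun z : EuclideanSpace ℝ (Fin 4) => 2⁻¹ * stdSymplecticForm z (v 0))
        ((2⁻¹ : ℝ) • stdSymplecticBilin.flip (v 0)) y := by
      have h := (stdSymplecticBilin.flip (v 0)).hasFDerivAt.const_mul (2⁻¹ : ℝ) (x := y)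
      refine h.congr_of_eventuallyEq (Eventually.of_forall fun z => ?_)
      simp [ContinuousLinearMap.flip_apply]
    refine (h1.mul h2).congr_of_eventuallyEq (Eventually.of_forall fun z => ?_)
    exact hθv z v
  -- the explicit formula for `dθ`
  have hΨv : ∀ y a b : EuclideanSpace ℝ (Fin 4), extDeriv θ y ![a, b] =
      f (‖y‖ ^ 2) * stdSymplecticForm a b + deriv f (‖y‖ ^ 2) *
        (⟪y, a⟫ * stdSymplecticForm y b - ⟪y, b⟫ * stdSymplecticForm y a) := by
    intro y a b
    rw [extDeriv_apply ((hθs.differentiable (by simp)) y), Fin.sum_univ_two]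
    have e0 : Fin.removeNth (0 : Fin 2) ![a, b] = ![b] := by
      funext i; fin_cases i; rfl
    have e1 : Fin.removeNth (1 : Fin 2) ![a, b] = ![a] := by
      funext i; fin_cases i; rfl
    rw [e0, e1, (hθd y ![b]).fderiv, (hθd y ![a]).fderiv]
    simp [ContinuousLinearMap.flip_apply, stdSymplecticForm_swap b a]
    ring
  have hΨs : ContDiff ℝ ∞ (extDeriv θ) := by
    unfold extDeriv
    exact (ContinuousAlternatingMap.alternatizeUncurryFinCLM ℝ (EuclideanSpace ℝ (Fin 4))
      ℝ).contDiff.comp (hθs.fderiv_right (m := ∞) (by norm_cast))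
  have hr : minSmoothness ℝ 2 ≤ ∞ := by
    rw [minSmoothness_of_isRCLikeNormedField]
    exact WithTop.coe_le_coe.2 le_top
  set Ψ : MForm 𝓘(ℝ, EuclideanSpace ℝ (Fin 4)) (EuclideanSpace ℝ (Fin 4)) ℝ 2 :=
    fun y => extDeriv θ y with hΨ
  refine ⟨Ψ, ?_, ?_, ?_, ?_, ?_⟩
  · -- smooth, as a form on the model space (identity charts)
    intro z
    have hin : Ψ.inChart z = fun y => extDeriv θ y := by
      funext y
      ext v
      simp [MForm.inChart_apply, hΨ]
      rfl
    rw [MForm.SmoothAt, hin]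
    simp only [modelWithCornersSelf_coe, range_id, extChartAt_self_apply]
    exact hΨs.contDiffAt.contDiffWithinAt
  · -- closed: `d ∘ d = 0` on `ℝ⁴`
    funext y
    rw [mextDeriv_eq_extDeriv]
    change extDeriv (extDeriv θ) y = 0
    rw [extDeriv_extDeriv hθs hr]
    rfl
  · -- locally constant profile
    intro y c hc u w
    change extDeriv θ y ![u, w] = c * stdSymplecticForm u w
    rw [hΨv, hc.deriv_eq, hc.self_of_nhds]
    simp
  · -- locally zero profile
    intro y h0
    change extDeriv θ y = 0
    refine twoForm_eq_of_apply_eq fun a b => ?_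
    rw [hΨv, h0.deriv_eq, h0.self_of_nhds]
    simp
  · -- domination on complex lines
    intro y u w huw
    change f (‖y‖ ^ 2) * ‖u‖ ^ 2 ≤ extDeriv θ y ![u, w]
    rw [hΨv, stdSymplecticForm_eq_norm_sq_of_inner_eq_std huw,
      stdSymplecticForm_left_eq_inner_of_inner_eq_std huw,
      stdSymplecticForm_eq_neg_inner_of_inner_eq_std huw y]
    have h := mul_nonneg (hf' (‖y‖ ^ 2)) (add_nonneg (sq_nonneg ⟪y, u⟫) (sq_nonneg ⟪y, w⟫))
    nlinarith [h]

end Summit.SmoothPoincare4.SmoothPoincare4.Theorems.WitnessCharge.PencilIncompleteness
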